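import Mathlib
import Summits.CriticalPhenomena.CardyFormulaZ2.Theorems.CardyFlipRussoSquareFromVoronoiHubDecimateForward
import Literature.Probability.Percolation.SitePaths
import HarnessLib

/-!
# Centre decimation, events `⇐` — stub `stub_decimateBackward` of line `centre-decimation`
# for crux `SquareFromVoronoiHub` (stmt-CriticalPhenomena-6434, route CardyFlipRusso, sub-problem CardyFormulaZ2)

We prove the backward half of the centre-decimation identity (CD) on the level of EVENTS (pure
combinatorics, no measure theory): if the relabelled configuration `decimate A ω = (ζ, σ)`
(`σ = {x | inl x ∈ ω}` the site colours, `ζ` the diagonal orientations, the centre coin flipped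
on the anti-diagonal faces `antiDiagFaces A ω`) lies in the random-diagonal connection event
`diagConn A B U V`, i.e. some `u ∈ U`, `v ∈ V ⊆ ℤ²` are joined by a `σ`-open path of
`diagGraph B ζ` inside `A`, then `ω ∈ gsConn A B U V`: `inl u` and `inl v` are joined by an open
path of the centred square lattice `G_s` inside the window `Sum.inl '' A ∪ Sum.inr '' B`.

Proof: turn the connection into a `PathIn` (`mem_siteConnIn_iff_pathIn`) and lift it edge by
edge (induction along the `Relation.ReflTransGen`).  A nearest-neighbour edge of `diagGraph` is a
site–site edge of `G_s`.  A SW–NE diagonal `f — f + (1,1)` (present only if `f ∈ B`, `f ∈ ζ`)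
with both ends open in `A` forces `f ∉ antiDiagFaces A ω`, so `f ∈ ζ` says the centre `inr f`
is open and the two `G_s` edges corner–centre–corner replace the diagonal.  A SE–NW diagonal
`f + (0,1) — f + (1,0)` (present only if `f ∈ B`, `f ∉ ζ`) with both ends open in `A`: if the SW
or the NE corner is an open site of `A` we detour through it by two site–site edges; otherwise
`f ∈ antiDiagFaces A ω` and `f ∉ ζ` says the centre is open, and again we pass through the
centre.  (Rolla, arXiv:1704.04930, §1; Beffara 2008, §5.1.)
-/

noncomputable section
open scoped Topology MeasureTheory
open Filter Set MeasureTheory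
open Literature.Probability.RandomPlanarGeometry (ConformalRectangle)
open Literature.Probability.Percolation (SiteConfig sitePercolation siteConnIn siteOpenGraph half
  centredSquareGraph centredSquareEmbedding)
open Summit.CriticalPhenomena.CardyFormulaZ2.Cruxes.SquareFromVoronoiHub.VoronoiBlocks (zGs Gs crudeCrossing)

namespace Summit.CriticalPhenomena.CardyFormulaZ2.Cruxes.SquareFromVoronoiHub.CentreDecimation

namespace stub_decimateBackwardAux

open Literature.Probability.Percolation
open stub_decimateForwardAux (inl_mem_window_iff inr_mem_window_iff diagGraph_adj_iff)

/-! ### Edges of `G_s` (construction direction) -/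

/-- The horizontal edges `inl x — inl (x + e₁)` of `ℤ²` are edges of `G_s`. [folklore] -/
theorem gsAdj_right (x : ℤ × ℤ) : Gs.Adj (Sum.inl x) (Sum.inl (x.1 + 1, x.2)) := by
  rw [Gs_eq_centredSquareGraph]
  exact centredSquareGraph_adj_inl_right x

/-- The vertical edges `inl x — inl (x + e₂)` of `ℤ²` are edges of `G_s`. [folklore] -/
theorem gsAdj_up (x : ℤ × ℤ) : Gs.Adj (Sum.inl x) (Sum.inl (x.1, x.2 + 1)) := by
  rw [Gs_eq_centredSquareGraph]
  exact centredSquareGraph_adj_inl_up x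

/-- A corner of the face `f` is adjacent in `G_s` to the centre `inr f`. [folklore] -/
theorem gsAdj_corner {x f : ℤ × ℤ}
    (h : (x.1 = f.1 ∨ x.1 = f.1 + 1) ∧ (x.2 = f.2 ∨ x.2 = f.2 + 1)) :
    Gs.Adj (Sum.inl x) (Sum.inr f) := by
  rw [Gs_eq_centredSquareGraph, centredSquareGraph_adj_inl_inr_iff]
  exact h

/-! ### The open window `(Sum.inl '' A ∪ Sum.inr '' B) ∩ ω` -/

/-- An open site of `A` (for the decimated colours `σ = (decimate A ω).2`) is an open vertex of
the window. [folklore] -/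
theorem inl_mem_openWindow {A B : Set (ℤ × ℤ)} {ω : SiteConfig ((ℤ × ℤ) ⊕ (ℤ × ℤ))} {x : ℤ × ℤ}
    (hx : x ∈ A ∩ (decimate A ω).2) :
    (Sum.inl x : (ℤ × ℤ) ⊕ (ℤ × ℤ)) ∈ (Sum.inl '' A ∪ Sum.inr '' B) ∩ ω :=
  ⟨inl_mem_window_iff.mpr hx.1, hx.2⟩

/-- An open centre of an admitted face `f ∈ B` is an open vertex of the window. [folklore] -/
theorem inr_mem_openWindow {A B : Set (ℤ × ℤ)} {ω : SiteConfig ((ℤ × ℤ) ⊕ (ℤ × ℤ))} {f : ℤ × ℤ}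
    (hB : f ∈ B) (hω : Sum.inr f ∈ ω) :
    (Sum.inr f : (ℤ × ℤ) ⊕ (ℤ × ℤ)) ∈ (Sum.inl '' A ∪ Sum.inr '' B) ∩ ω :=
  ⟨inr_mem_window_iff.mpr hB, hω⟩

/-! ### Replacing a diagonal by a two-edge path of `G_s` -/

/-- **Through the centre.**  Two corners of an admitted face `f ∈ B` with open centre, both open
vertices of the window, are joined by the open `G_s`-path corner — centre — corner. [folklore] -/
theorem centre_path {A B : Set (ℤ × ℤ)} {ω : SiteConfig ((ℤ × ℤ) ⊕ (ℤ × ℤ))} {f x y : ℤ × ℤ}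
    (hB : f ∈ B) (hω : Sum.inr f ∈ ω)
    (hx : (x.1 = f.1 ∨ x.1 = f.1 + 1) ∧ (x.2 = f.2 ∨ x.2 = f.2 + 1))
    (hy : (y.1 = f.1 ∨ y.1 = f.1 + 1) ∧ (y.2 = f.2 ∨ y.2 = f.2 + 1))
    (hxW : (Sum.inl x : (ℤ × ℤ) ⊕ (ℤ × ℤ)) ∈ (Sum.inl '' A ∪ Sum.inr '' B) ∩ ω)
    (hyW : (Sum.inl y : (ℤ × ℤ) ⊕ (ℤ × ℤ)) ∈ (Sum.inl '' A ∪ Sum.inr '' B) ∩ ω) :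
    PathIn Gs ((Sum.inl '' A ∪ Sum.inr '' B) ∩ ω) (Sum.inl x) (Sum.inl y) :=
  (PathIn.of_adj hxW (inr_mem_openWindow hB hω) (gsAdj_corner hx)).tail
    (gsAdj_corner hy).symm hyW

/-- **SW–NE diagonal.**  If `f ∈ B`, `f ∈ ζ` and both ends `f`, `f + (1,1)` of the diagonal are
open sites of `A`, then `f` is not an anti-diagonal face, so `f ∈ ζ` means that the centre
`inr f` is open, and the diagonal lifts to the path through the centre. [folklore] -/
theorem diag_lift {A B : Set (ℤ × ℤ)} {ω : SiteConfig ((ℤ × ℤ) ⊕ (ℤ × ℤ))} {f : ℤ × ℤ}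
    (hB : f ∈ B) (hζ : f ∈ (decimate A ω).1)
    (h00 : f ∈ A ∩ (decimate A ω).2) (h11 : (f.1 + 1, f.2 + 1) ∈ A ∩ (decimate A ω).2) :
    PathIn Gs ((Sum.inl '' A ∪ Sum.inr '' B) ∩ ω) (Sum.inl f) (Sum.inl (f.1 + 1, f.2 + 1)) := by
  have hω : Sum.inr f ∈ ω :=
    (show Sum.inr f ∈ ω ↔ f ∉ antiDiagFaces A ω from hζ).mpr fun h => h.2.2.1 h00
  exact centre_path hB hω ⟨Or.inl rfl, Or.inl rfl⟩ ⟨Or.inr rfl, Or.inr rfl⟩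
    (inl_mem_openWindow h00) (inl_mem_openWindow h11)

/-- **SE–NW diagonal.**  If `f ∈ B`, `f ∉ ζ` and both ends `f + (0,1)`, `f + (1,0)` of the
anti-diagonal are open sites of `A`, they are joined by an open `G_s`-path inside the window:
through the SW or the NE corner if one of them is an open site of `A`, and otherwise `f` is an
anti-diagonal face, so `f ∉ ζ` means that the centre is open and we pass through it. [folklore] -/
theorem antidiag_lift {A B : Set (ℤ × ℤ)} {ω : SiteConfig ((ℤ × ℤ) ⊕ (ℤ × ℤ))} {f : ℤ × ℤ}
    (hB : f ∈ B) (hζ : f ∉ (decimate A ω).1)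
    (h01 : (f.1, f.2 + 1) ∈ A ∩ (decimate A ω).2) (h10 : (f.1 + 1, f.2) ∈ A ∩ (decimate A ω).2) :
    PathIn Gs ((Sum.inl '' A ∪ Sum.inr '' B) ∩ ω)
      (Sum.inl (f.1, f.2 + 1)) (Sum.inl (f.1 + 1, f.2)) := by
  by_cases h00 : f ∈ A ∩ (decimate A ω).2
  · exact (PathIn.of_adj (inl_mem_openWindow h01) (inl_mem_openWindow h00)
      (gsAdj_up f).symm).tail (gsAdj_right f) (inl_mem_openWindow h10)
  by_cases h11 : (f.1 + 1, f.2 + 1) ∈ A ∩ (decimate A ω).2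
  · exact (PathIn.of_adj (inl_mem_openWindow h01) (inl_mem_openWindow h11)
      (gsAdj_right (f.1, f.2 + 1))).tail (gsAdj_up (f.1 + 1, f.2)).symm
      (inl_mem_openWindow h10)
  have hanti : f ∈ antiDiagFaces A ω := ⟨h10, h01, h00, h11⟩
  have hω : Sum.inr f ∈ ω := by
    by_contra hω
    exact hζ (show Sum.inr f ∈ ω ↔ f ∉ antiDiagFaces A ω from
      iff_of_false hω (not_not_intro hanti))
  exact centre_path hB hω ⟨Or.inl rfl, Or.inr rfl⟩ ⟨Or.inr rfl, Or.inl rfl⟩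
    (inl_mem_openWindow h01) (inl_mem_openWindow h10)

/-! ### Lifting edges and paths of `diagGraph B ζ` -/

/-- **One generating step.**  A step `x → y` of the relation generating `diagGraph B ζ`, between
open sites of `A`, lifts to an open `G_s`-path inside the window. [folklore] -/
theorem rel_lift {A B : Set (ℤ × ℤ)} {ω : SiteConfig ((ℤ × ℤ) ⊕ (ℤ × ℤ))} {x y : ℤ × ℤ}
    (hx : x ∈ A ∩ (decimate A ω).2) (hy : y ∈ A ∩ (decimate A ω).2)
    (h : y = (x.1 + 1, x.2) ∨ y = (x.1, x.2 + 1) ∨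
      (x ∈ B ∧ x ∈ (decimate A ω).1 ∧ y = (x.1 + 1, x.2 + 1)) ∨
      ((x.1, x.2 - 1) ∈ B ∧ (x.1, x.2 - 1) ∉ (decimate A ω).1 ∧ y = (x.1 + 1, x.2 - 1))) :
    PathIn Gs ((Sum.inl '' A ∪ Sum.inr '' B) ∩ ω) (Sum.inl x) (Sum.inl y) := by
  rcases h with rfl | rfl | ⟨hB, hζ, rfl⟩ | ⟨hB, hζ, rfl⟩
  · exact PathIn.of_adj (inl_mem_openWindow hx) (inl_mem_openWindow hy) (gsAdj_right x)
  · exact PathIn.of_adj (inl_mem_openWindow hx) (inl_mem_openWindow hy) (gsAdj_up x)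
  · exact diag_lift hB hζ hx hy
  · obtain ⟨a, b⟩ := x
    have e : (((a, b - 1) : ℤ × ℤ).1, ((a, b - 1) : ℤ × ℤ).2 + 1) = (a, b) :=
      Prod.ext rfl (sub_add_cancel b 1)
    have h01 : (((a, b - 1) : ℤ × ℤ).1, ((a, b - 1) : ℤ × ℤ).2 + 1) ∈ A ∩ (decimate A ω).2 := by
      rw [e]
      exact hx
    have key := antidiag_lift (B := B) hB hζ h01 hy
    rw [e] at key
    exact key

/-- **One edge.**  An edge of `diagGraph B ζ` between open sites of `A` lifts to an open
`G_s`-path inside the window (`SimpleGraph.fromRel` symmetrises: use `rel_lift` in one of the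
two orientations and reverse if needed). [folklore] -/
theorem adj_lift {A B : Set (ℤ × ℤ)} {ω : SiteConfig ((ℤ × ℤ) ⊕ (ℤ × ℤ))} {x y : ℤ × ℤ}
    (hx : x ∈ A ∩ (decimate A ω).2) (hy : y ∈ A ∩ (decimate A ω).2)
    (h : (diagGraph B (decimate A ω).1).Adj x y) :
    PathIn Gs ((Sum.inl '' A ∪ Sum.inr '' B) ∩ ω) (Sum.inl x) (Sum.inl y) := by
  rw [diagGraph_adj_iff] at h
  rcases h.2 with h | h
  · exact rel_lift hx hy h
  · exact (rel_lift hy hx h).symm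

/-- **Lifting an open random-diagonal path.**  A `σ`-open path of `diagGraph B ζ` inside `A`
from `u` to `v`, where `(ζ, σ) = decimate A ω`, lifts to an open `G_s`-path inside the window
from `inl u` to `inl v` (induction along the path, one edge at a time). [folklore] -/
theorem pathIn_lift {A B : Set (ℤ × ℤ)} {ω : SiteConfig ((ℤ × ℤ) ⊕ (ℤ × ℤ))} {u v : ℤ × ℤ}
    (h : PathIn (diagGraph B (decimate A ω).1) (A ∩ (decimate A ω).2) u v) :
    PathIn Gs ((Sum.inl '' A ∪ Sum.inr '' B) ∩ ω) (Sum.inl u) (Sum.inl v) := by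
  obtain ⟨hu, h⟩ := h
  induction h with
  | refl => exact PathIn.refl (inl_mem_openWindow hu)
  | @tail b c hub hbc ih =>
    have hbP : PathIn (diagGraph B (decimate A ω).1) (A ∩ (decimate A ω).2) u b := ⟨hu, hub⟩
    exact ih.trans (adj_lift hbP.right_mem hbc.2 hbc.1)

end stub_decimateBackwardAux

/-- **stub_decimateBackward** (CD, events, `⇐`): an open random-diagonal connection from `u` to
`v` inside `A` (diagonals admitted in `B`) of the decimated configuration `decimate A ω` comes
from an open `G_s` connection from `inl u` to `inl v` inside the window `inl '' A ∪ inr '' B`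
(each diagonal is replaced by the two centre–corner edges of its face, whose centre the
relabelled coin declares open, or by a detour through a third open corner). -/
theorem stub_decimateBackward :
    ∀ (A B U V : Set (ℤ × ℤ)) (ω : SiteConfig ((ℤ × ℤ) ⊕ (ℤ × ℤ))),
      decimate A ω ∈ diagConn A B U V → ω ∈ gsConn A B U V := by
  rintro A B U V ω ⟨u, hu, v, hv, h⟩
  exact ⟨u, hu, v, hv, Literature.Probability.Percolation.mem_siteConnIn_iff_pathIn.2
    (stub_decimateBackwardAux.pathIn_lift
      (Literature.Probability.Percolation.mem_siteConnIn_iff_pathIn.1 h))⟩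

end Summit.CriticalPhenomena.CardyFormulaZ2.Cruxes.SquareFromVoronoiHub.CentreDecimation
end
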